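import Summits.CriticalPhenomena.PercolationContinuityZ3.Theorems.PercNearOneGluingNoHeavyQuantFarRelayRow
import HarnessLib

/-!
# QUANT lane R8: two free reductions of the far-relay row (FAR) — WLOG the observer is not a relay, WLOG the relay set is minimal

builds on p205010 (kernel theorem, internal audit signed; external expert review pending)

Support file (`--supports stmt-CriticalPhenomena-4575`), seat `prim-quant-census-1` (gen 5); memo
`run/shared/lean/prim/quant/CENSUS-GAIN.md` §13 (FAR census through a third exact engine, mass rows, climbs, structure of a
would-be counterexample).  No definitions, no named facts, no sorries; standard axioms.

`Quant.FarRelayRow` (FAR, lead g4, `…QuantFarRelayRow.lean`) says: on every finite weighted graph, for every vertex `o`, vertex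
set `A`, layer `j` and `t`, if `2j < Σ_{a∈A} P(o ↔ a)` and `P(o ↮ a) ≤ t` for all `a ∈ A` then `P(#{a ∈ A | o ↔ a} ≤ j) ≤ t`
(the observer counts itself when `o ∈ A`).  Whoever attacks FAR may assume, at no cost:

* `QuantCensus.farRelayRow_of_notMem` — **WLOG `o ∉ A`.**  If `o ∈ A` then `N_A = N_{A∖o} + 1` surely and
  `Σ_A P(o ↔ a) = 1 + Σ_{A∖o} P(o ↔ a)`, so the instance `(A, j)` is the instance `(A ∖ o, j − 1)`, whose hypothesis
  `2(j−1) < Σ_{A∖o}` is WEAKER than the given `2j < 1 + Σ_{A∖o}` (and `j = 0` is vacuous: `N_A ≥ 1`).  So the `o ∈ A` cell of the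
  census at layer `j` is implied by the `o ∉ A` cell at layer `j − 1`; FAR restricted to `o ∉ A` implies FAR.
* `QuantCensus.farRelayRow_of_core` — **WLOG `A` is minimal**: `o ∉ A` and `Σ_{a∈A} P(o ↔ a) − P(o ↔ b) ≤ 2j` for every `b ∈ A`
  (removing ANY relay kills the hypothesis).  If some `b` can be removed with the hypothesis intact, the instance for `A ∖ b`
  gives `P(N_{A∖b} ≤ j) ≤ t`, and `N_A ≥ N_{A∖b}`; induction on `|A|`.  In the core every relay is individually needed, in
  particular `2j < Σ_A P(o ↔ a) ≤ 2j + min_a P(o ↔ a) ≤ 2j + 1` and `|A| ≥ 2j + 1`.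

Census remark (CENSUS-GAIN §13): FAR holds with `0` violations on all connected graphs `n ≤ 7` × 9 palettes (6.9 M placements, third
engine), on the mass (blob) rows `n ≤ 6`, on the layer-4 counterexample anatomies (ratio ≤ 0.26) and under capped free-weight /
fixed-mass climbs `n ≤ 8` (10 040 restarts); `= 1` exactly only on the two-block glue family `o —h— B₁ (j relays), o —g— B₂ (j+1 relays)`.
[cite: KozmaNitzan2024, Lemma 2 (p. 6), Conjecture 3 (p. 15)]
-/

noncomputable section

namespace Summit.CriticalPhenomena.PercolationContinuityZ3.Theorems

open MeasureTheory Set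
open Literature.Probability.LatticeModels (prodBernoulli)
open Literature.Probability.Percolation
open scoped Classical

namespace QuantCensus

/-- Every configuration connects a vertex to itself: `ω ∈ {o ↔ o}`. [folklore] -/
theorem mem_openConn_self {n : ℕ} (o : Fin n) (ω : BondConfig (Fin n)) :
    ω ∈ (openConn o o : Set (BondConfig (Fin n))) :=
  (SimpleGraph.Reachable.refl o : (openGraph ω).Reachable o o)

/-- If `o ∈ A`, the observer's relay count over `A` is one more than over `A.erase o`, surely. [folklore] -/
theorem card_filter_conn_eq_erase_add_one {n : ℕ} (A : Finset (Fin n)) (o : Fin n) (ho : o ∈ A)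
    (ω : BondConfig (Fin n)) :
    (A.filter fun a => ω ∈ openConn o a).card = ((A.erase o).filter fun a => ω ∈ openConn o a).card + 1 := by
  have hins : A = insert o (A.erase o) := (Finset.insert_erase ho).symm
  conv_lhs => rw [hins]
  rw [Finset.filter_insert, if_pos (mem_openConn_self o ω), Finset.card_insert_of_notMem]
  intro hmem
  exact (Finset.notMem_erase o A) (Finset.mem_filter.1 hmem).1

/-- If `o ∈ A` then `Σ_{a∈A} P(o ↔ a) = 1 + Σ_{a ∈ A.erase o} P(o ↔ a)`. [folklore] -/
theorem sum_conn_eq_one_add_erase {n : ℕ} (w : Sym2 (Fin n) → unitInterval) (A : Finset (Fin n)) (o : Fin n)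
    (ho : o ∈ A) :
    ∑ a ∈ A, (prodBernoulli w).real (openConn o a : Set (BondConfig (Fin n))) =
      1 + ∑ a ∈ A.erase o, (prodBernoulli w).real (openConn o a : Set (BondConfig (Fin n))) := by
  rw [← Finset.add_sum_erase A _ ho]
  congr 1
  have : (openConn o o : Set (BondConfig (Fin n))) = Set.univ := Set.eq_univ_of_forall (mem_openConn_self o)
  rw [this, probReal_univ]

/-- **WLOG the observer is not a relay.**  If the far-relay row holds for all placements with `o ∉ A`, it holds for all
placements: for `o ∈ A` the instance `(A, j)` is the instance `(A.erase o, j − 1)` (the observer counts itself, `N_A = N_{A∖o} + 1`,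
`Σ_A = 1 + Σ_{A∖o}`), whose mean hypothesis is weaker; `j = 0` is vacuous. [this work] -/
theorem farRelayRow_of_notMem
    (h : ∀ (n : ℕ) (w : Sym2 (Fin n) → unitInterval) (A : Finset (Fin n)) (o : Fin n) (j : ℕ) (t : ℝ), o ∉ A →
      (2 * j : ℝ) < ∑ a ∈ A, (prodBernoulli w).real (openConn o a) →
      (∀ a ∈ A, (prodBernoulli w).real (openConn o a)ᶜ ≤ t) →
      (prodBernoulli w).real {ω : BondConfig (Fin n) | (A.filter fun a => ω ∈ openConn o a).card ≤ j} ≤ t) :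
    Quant.FarRelayRow := by
  intro n w A o j t hEN ht
  by_cases ho : o ∈ A
  swap
  · exact h n w A o j t ho hEN ht
  have ht0 : 0 ≤ t := le_trans measureReal_nonneg (ht o ho)
  have hcard := card_filter_conn_eq_erase_add_one A o ho
  have hsum := sum_conn_eq_one_add_erase w A o ho
  have hoA' : o ∉ A.erase o := Finset.notMem_erase o A
  rcases Nat.eq_zero_or_pos j with hj | hj
  · -- `j = 0`: the event is empty since `N_A ≥ 1`
    subst hj
    have hempty : {ω : BondConfig (Fin n) | (A.filter fun a => ω ∈ openConn o a).card ≤ 0} = ∅ := by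
      rw [Set.eq_empty_iff_forall_notMem]
      intro ω hω
      have h1 := hcard ω
      have h2 : (A.filter fun a => ω ∈ openConn o a).card ≤ 0 := hω
      omega
    rw [hempty, measureReal_empty]
    exact ht0
  · -- `j ≥ 1`: apply the `o ∉ A` instance to `(A.erase o, j - 1)`
    obtain ⟨j', rfl⟩ : ∃ j', j = j' + 1 := ⟨j - 1, by omega⟩
    have hEN' : (2 * j' : ℝ) < ∑ a ∈ A.erase o, (prodBernoulli w).real (openConn o a : Set (BondConfig (Fin n))) := by
      push_cast at hEN
      linarith
    have ht' : ∀ a ∈ A.erase o, (prodBernoulli w).real (openConn o a : Set (BondConfig (Fin n)))ᶜ ≤ t :=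
      fun a ha => ht a (Finset.mem_of_mem_erase ha)
    have hfar := h n w (A.erase o) o j' t hoA' hEN' ht'
    have hset : {ω : BondConfig (Fin n) | (A.filter fun a => ω ∈ openConn o a).card ≤ j' + 1} =
        {ω | ((A.erase o).filter fun a => ω ∈ openConn o a).card ≤ j'} := by
      ext ω
      simp only [Set.mem_setOf_eq]
      rw [hcard ω]
      omega
    rw [hset]
    exact hfar

/-- **WLOG the relay set is minimal (and the observer is not a relay).**  If the far-relay row holds for all placements with
`o ∉ A` in which every relay is individually needed for the mean hypothesis (`Σ_{a∈A} P(o ↔ a) − P(o ↔ b) ≤ 2j` for all `b ∈ A`),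
it holds for all placements: a removable relay `b` is removed (`N_A ≥ N_{A∖b}`, the cut hypotheses restrict), by induction on `|A|`;
then `farRelayRow_of_notMem`. [this work] -/
theorem farRelayRow_of_core
    (h : ∀ (n : ℕ) (w : Sym2 (Fin n) → unitInterval) (A : Finset (Fin n)) (o : Fin n) (j : ℕ) (t : ℝ), o ∉ A →
      (∀ b ∈ A, ∑ a ∈ A, (prodBernoulli w).real (openConn o a) - (prodBernoulli w).real (openConn o b) ≤ (2 * j : ℝ)) →
      (2 * j : ℝ) < ∑ a ∈ A, (prodBernoulli w).real (openConn o a) →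
      (∀ a ∈ A, (prodBernoulli w).real (openConn o a)ᶜ ≤ t) →
      (prodBernoulli w).real {ω : BondConfig (Fin n) | (A.filter fun a => ω ∈ openConn o a).card ≤ j} ≤ t) :
    Quant.FarRelayRow := by
  apply farRelayRow_of_notMem
  intro n w A
  induction A using Finset.strongInduction with
  | H A ih =>
    intro o j t ho hEN ht
    by_cases hmin : ∀ b ∈ A, ∑ a ∈ A, (prodBernoulli w).real (openConn o a : Set (BondConfig (Fin n))) -
        (prodBernoulli w).real (openConn o b : Set (BondConfig (Fin n))) ≤ (2 * j : ℝ)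
    · exact h n w A o j t ho hmin hEN ht
    · push Not at hmin
      obtain ⟨b, hb, hbig⟩ := hmin
      have hsub : A.erase b ⊂ A := Finset.erase_ssubset hb
      have hEN' : (2 * j : ℝ) < ∑ a ∈ A.erase b, (prodBernoulli w).real (openConn o a : Set (BondConfig (Fin n))) := by
        rw [Finset.sum_erase_eq_sub hb]
        exact hbig
      have hoe : o ∉ A.erase b := fun hm => ho (Finset.mem_of_mem_erase hm)
      have hte : ∀ a ∈ A.erase b, (prodBernoulli w).real (openConn o a : Set (BondConfig (Fin n)))ᶜ ≤ t :=
        fun a ha => ht a (Finset.mem_of_mem_erase ha)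
      have hfar := ih (A.erase b) hsub o j t hoe hEN' hte
      refine le_trans (measureReal_mono ?_ (measure_ne_top _ _)) hfar
      intro ω hω
      have hω' : (A.filter fun a => ω ∈ openConn o a).card ≤ j := hω
      show ((A.erase b).filter fun a => ω ∈ openConn o a).card ≤ j
      exact le_trans (Finset.card_le_card (Finset.filter_subset_filter _ (Finset.erase_subset b A))) hω'

/-- In the minimal core the mean is pinned just above the threshold: if every relay is needed then
`Σ_{a∈A} P(o ↔ a) ≤ 2j + P(o ↔ b)` for every `b ∈ A` (in particular `≤ 2j + 1`), and `|A| ≥ 2j + 1`. [this work] -/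
theorem core_card_ge {n : ℕ} (w : Sym2 (Fin n) → unitInterval) (A : Finset (Fin n)) (o : Fin n) (j : ℕ)
    (hEN : (2 * j : ℝ) < ∑ a ∈ A, (prodBernoulli w).real (openConn o a : Set (BondConfig (Fin n)))) :
    2 * j + 1 ≤ A.card := by
  have hle : ∑ a ∈ A, (prodBernoulli w).real (openConn o a : Set (BondConfig (Fin n))) ≤ ∑ a ∈ A, (1 : ℝ) :=
    Finset.sum_le_sum fun a _ => measureReal_le_one
  rw [Finset.sum_const, nsmul_eq_mul, mul_one] at hle
  have : (2 * j : ℝ) < A.card := lt_of_lt_of_le hEN hle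
  exact_mod_cast this

end QuantCensus

end Summit.CriticalPhenomena.PercolationContinuityZ3.Theorems

end
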